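import Summits.ABC.IUTFork.Conditional.FreyHullThresholdGenuineWildUnitExact
import Summits.ABC.IUTFork.Conditional.AbcOfSGenuineKTameRobustRows5
import HarnessLib

/-!
# R-W «W:REF-BANDS-WILD-EXACT» — the 223³-triple at its W2 pole `p = 5`: S_H FAILS at EVERY genuine Θ-volume datum over
# `(ratPoint (a/c), l)` for EVERY prime `7 ≤ l ≤ 4079` — ONE band theorem (the pinned/tabulated rows continued beyond the N3 prefix `l ≤ 397`)

PROOF-ONLY file (no `def`, no new `Prop`, no instance) of the abc-iut cell (rung LADDER-ABC:A2.RESCUE.W; seat abc-iut-w5-d180 gen 10, row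
«W:REF-BANDS-WILD-EXACT», plan C-R88 (a)(ii); the R-W numerics lead's REF-BANDS-EXACT-CERTS / GAP-EXACT v2 re-evaluated with the EXACT W2 different,
desk HOME/staging/w5/w5-d180/g10/REF-BANDS-WILD-EXACT.txt d92cbf25b0c753df: band 3,049 → 4,079). TAKES NO SIDE on [IUTchIII] Cor. 3.12 or on any author.

The triple `2¹²·13³·223³ + 3¹⁵·11³·97⁵·409 = 5¹⁵·179⁴·2141` (the tree's `isABCTriple_frey99794037551104`) has a pole of `j(a/c)` of order `2t = 30` at `p = 5`
with `5 ∣ t` and the W2 unit test `5 ∣ D`, `25 ∤ D` (`D = ((abc/5¹⁵)²)⁴ − (2⁸(cb + a²)³)⁴`, a 558-digit integer; `norm_num`), so EVERY completion `K_{x₀}`,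
`x₀ ∣ 5`, of every genuine datum over `(ratPoint (a/c), l)` (`l ≠ 5`) has `e = 20·l` and the EXACT different `d = (24·l − 1)/(20·l)` (abc-iut-W-neg-1's type +
abc-iut-w5-d180's `GenuineK.differentOrd_kOf_eq_wildUnit_ratPoint`). The `δ`-cell of the W2 engine (`GenuineK.not_pilotKummerCompatHull_chosen_triple_of_wildUnitCell`)
at the TOP label `i + 1 = l⋆ = (l−1)/2`, written in `l = 2(k+1) + 1`, is ONE integer polynomial inequality per turning-point piece `a₀ ∈ {3,4,5,6,7}`
(`l ≤ 25 / 125 / 625 / 3125 / 4079`): `R(k) − L(k) ≥ 0` with `R − L = 122k² + 110k − 273`, `82k² + 470k + 607`, `42k² + 2830k + 5487`, `2k² + 15190k + 30367`,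
`−38k² + 77550k + 155247` respectively — the last one positive exactly for `k ≤ 2040`, i.e. `l ≤ 4083`: the band ENDS at the prime `4079` (at `4091` the
cell holds). The integer division of the engine's cell is removed by `e·⌊X/e⌋ > X − e` (`lt_mul_ediv_of_add_le`).

* `WildUnitCells.frey99794037551104_five_band` — the cell table, symbolic in `l` (five pieces, `nlinarith`);
* **`GenuineK.not_pilotKummerCompatHull_chosen_frey99794037551104_five_band`** — for EVERY prime `7 ≤ l ≤ 4079` and EVERY genuine Θ-volume datum `T`
  over `(ratPoint (2¹²13³223³ / 5¹⁵179⁴2141), l)`: the hull-level clause S_H (`Cor312Vol.PilotKummerCompatHull`, chosen realising ideles, pinned reading)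
  FAILS for every choice of the free context binders and Kummer data — 556 primes in ONE theorem (the N3 prefix rows `l ≤ 397` of this triple were
  refuted one `l` at a time; `l = 97` at `p = 3` by abc-iut-w4-d094's p493205).

NOT claimed: admissibility / Szpiro-badness / (P6) of `(ratPoint (a/c), l)` at these `l`, non-emptiness of the datum type; «refuted as typed» ≠
«refuted in print»; nothing about the number-level Corollary; typed ≠ proved; instantiated ≠ endorsed; no abc claim.
[cite: Mochizuki2012, IUTchIII Cor. 3.12 Step (xi-f) p. 184; IUTchIV Prop. 1.2 (i)(ii) p. 10, Prop. 1.3 (i) p. 11, Cor. 2.2 (ii) proof p. 44]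
[cite: SerreLocalFields1979, Ch. III §6 Prop. 13] [cite: Serre1973, Ch. II §3.3] [claim: Mochizuki2012, status: disputed] for every IUT sentence quoted.
-/

noncomputable section

open Set Function NumberField IsDedekindDomain

namespace Summit.ABC.IUTFork.Conditional

open Thm311 Thm311.Real Cor312 Cor312Vol Cor312Prov Literature.IUT.LogThetaLattice Literature.IUT.LogVolume
  Literature.IUT.HodgeTheaters Literature.IUT.LogVolume.ThetaData
  Literature.NumberTheory.NumberFields Literature.NumberTheory.DiophantineGeometry.GenEll
  Literature.NumberTheory.DiophantineGeometry Summit.ABC.ABC.Theorems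

/-! ## §0. Removing the integer division of the cell -/

/-- `L + d ≤ X ⇒ L < d·⌊X/d⌋` for `d > 0` (`d·⌊X/d⌋ = X − (X mod d) > X − d`). [folklore] -/
private theorem lt_mul_ediv_of_add_le {L X d : ℤ} (hd : 0 < d) (h : L + d ≤ X) : L < d * (X / d) := by
  have h1 := Int.mul_ediv_add_emod X d
  have h2 := Int.emod_lt_of_pos X hd
  have h3 := Int.emod_nonneg X hd.ne'
  linarith

/-! ## §1. The cell table of the 223³-triple at `p = 5` (W2, `A = 20`, `P_q = 300`), symbolic in the prime `7 ≤ l ≤ 4079` -/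

/-- **Cell table, 223³-triple at `p = 5`, EVERY prime `7 ≤ l ≤ 4079`:** at `A = 5·4·(3/gcd(3,15)) = 20` the W2 `δ`-cell (`δ = 24·l − 1`, `r_in = 5l + 1`,
`r_out = 5^{a₀} − 20·a₀·l`, `P_q = 300`, top label) FAILS, with the turning point `a₀ = 3, 4, 5, 6, 7` on `l ≤ 25`, `≤ 125`, `≤ 625`, `≤ 3125`, `≤ 4079`.
[cite: Mochizuki2012, IUTchIV Prop. 1.2 (i)(ii) p. 10] [claim: Mochizuki2012, status: disputed] -/
theorem WildUnitCells.frey99794037551104_five_band {l : ℕ} (hl : l.Prime) (h7 : 7 ≤ l) (h4079 : l ≤ 4079) :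
    ∀ A : ℕ, A = (5 : ℕ) * ((5 : ℕ) - 1) * (3 / Nat.gcd 3 15) →
      ∃ a₀ : ℕ, (∀ a, a < a₀ → (1 : ℤ) * ((5 : ℕ) : ℤ) ^ a * (((5 : ℕ) : ℤ) - 1) < ((A * l : ℕ) : ℤ)) ∧
        ((A * l : ℕ) : ℤ) ≤ 1 * ((5 : ℕ) : ℤ) ^ a₀ * (((5 : ℕ) : ℤ) - 1) ∧
        ((A * 15 : ℕ) : ℤ) - (((((l - 1) / 2 - 1 : ℕ) : ℕ) : ℤ) + 1 + 1) * (((5 : ℕ) : ℤ) ^ a₀ - (a₀ : ℤ) * ((A * l : ℕ) : ℤ)) <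
          ((A * l : ℕ) : ℤ) * (((((((l - 1) / 2 - 1 : ℕ) : ℕ) : ℤ) + 1) ^ 2 * ((A * 15 : ℕ) : ℤ)
            - (((((l - 1) / 2 - 1 : ℕ) : ℕ) : ℤ) + 1) * (((A * l + A * l / (5 : ℕ) - 1 : ℕ) : ℤ))
            - (((((l - 1) / 2 - 1 : ℕ) : ℕ) : ℤ) + 1 + 1) * (((A * l) / ((5 : ℕ) - 1) + 1 : ℕ) : ℤ)) / ((A * l : ℕ) : ℤ)) := by
  intro A hA
  have hA20 : A = 20 := by rw [hA]; norm_num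
  subst hA20
  have hl2 : l ≠ 2 := by omega
  obtain ⟨m, hm⟩ := hl.odd_of_ne_two hl2
  subst hm
  obtain ⟨k, rfl⟩ : ∃ k, m = k + 1 := ⟨m - 1, by omega⟩
  have hk2 : 2 ≤ k := by omega
  have hk2038 : k ≤ 2038 := by omega
  -- normalise the natural-number arithmetic inside the casts
  have e0 : (2 * (k + 1) + 1 - 1) / 2 - 1 = k := by omega
  have e1 : 20 * (2 * (k + 1) + 1) + 20 * (2 * (k + 1) + 1) / (5 : ℕ) - 1 = 48 * k + 71 := by omega
  have e2 : 20 * (2 * (k + 1) + 1) / ((5 : ℕ) - 1) + 1 = 10 * k + 16 := by omega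
  have e3 : 20 * (2 * (k + 1) + 1) = 40 * k + 60 := by ring
  rw [e0, e1, e2, e3]
  have hd : (0 : ℤ) < ((40 * k + 60 : ℕ) : ℤ) := by positivity
  have hkz : (2 : ℤ) ≤ (k : ℤ) := by exact_mod_cast hk2
  have hkz' : (k : ℤ) ≤ 2038 := by exact_mod_cast hk2038
  by_cases hA3 : k ≤ 11
  · refine ⟨3, ?_, ?_, ?_⟩
    · intro a ha
      interval_cases a <;> push_cast <;> omega
    · push_cast; omega
    · refine lt_mul_ediv_of_add_le hd ?_
      push_cast
      nlinarith [mul_nonneg (sub_nonneg.2 hkz) (by positivity : (0 : ℤ) ≤ (k : ℤ))]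
  by_cases hA4 : k ≤ 61
  · refine ⟨4, ?_, ?_, ?_⟩
    · intro a ha
      interval_cases a <;> push_cast <;> omega
    · push_cast; omega
    · refine lt_mul_ediv_of_add_le hd ?_
      push_cast
      nlinarith [mul_nonneg (sub_nonneg.2 hkz) (by positivity : (0 : ℤ) ≤ (k : ℤ))]
  by_cases hA5 : k ≤ 311
  · refine ⟨5, ?_, ?_, ?_⟩
    · intro a ha
      interval_cases a <;> push_cast <;> omega
    · push_cast; omega
    · refine lt_mul_ediv_of_add_le hd ?_
      push_cast
      nlinarith [mul_nonneg (sub_nonneg.2 hkz) (by positivity : (0 : ℤ) ≤ (k : ℤ))]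
  by_cases hA6 : k ≤ 1561
  · refine ⟨6, ?_, ?_, ?_⟩
    · intro a ha
      interval_cases a <;> push_cast <;> omega
    · push_cast; omega
    · refine lt_mul_ediv_of_add_le hd ?_
      push_cast
      nlinarith [mul_nonneg (sub_nonneg.2 hkz) (by positivity : (0 : ℤ) ≤ (k : ℤ))]
  · refine ⟨7, ?_, ?_, ?_⟩
    · intro a ha
      interval_cases a <;> push_cast <;> omega
    · push_cast; omega
    · refine lt_mul_ediv_of_add_le hd ?_
      push_cast
      nlinarith [mul_nonneg (sub_nonneg.2 hkz') (by positivity : (0 : ℤ) ≤ (k : ℤ))]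

/-! ## §2. The band: S_H FAILS at every genuine datum over `(ratPoint (a/c), l)`, every prime `7 ≤ l ≤ 4079` -/

/-- **R-W BAND `pilotDataOfK:frey-99794037551104-…:l`, EVERY prime `7 ≤ l ≤ 4079` — REFUTED side, UNCONDITIONALLY, at the WILD pole `p = 5` (type W2 by
theorem: `5 ∣ D`, `25 ∤ D`) of `2¹²·13³·223³ + 3¹⁵·11³·97⁵·409 = 5¹⁵·179⁴·2141`:** for EVERY genuine Θ-volume datum `T` over `(ratPoint (a/c), l)` and
EVERY choice of the free context binders and Kummer data, the hull-level clause S_H (`Cor312Vol.PilotKummerCompatHull`, chosen realising ideles, pinned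
reading) FAILS — W2 engine `GenuineK.not_pilotKummerCompatHull_chosen_triple_of_wildUnitCell` (exact type `e = 20·l`, exact different `δ = 24l − 1`)
at the top label with the symbolic cell table `WildUnitCells.frey99794037551104_five_band`. 556 primes; the band ends at `4079` (the cell holds at `4091`).
NOT claimed: admissibility / Szpiro-badness / (P6) of `(ratPoint (a/c), l)`, non-emptiness of the datum type; refuted-as-typed ≠ refuted-in-print.
[cite: Mochizuki2012, IUTchIII Cor. 3.12 Step (xi-f) p. 184; IUTchIV Prop. 1.2 (i)(ii) p. 10, Prop. 1.3 (i) p. 11] [claim: Mochizuki2012, status: disputed] -/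
theorem GenuineK.not_pilotKummerCompatHull_chosen_frey99794037551104_five_band {l : ℕ} (hl : l.Prime) (h7 : 7 ≤ l) (h4079 : l ≤ 4079)
    (T : Cor22.ThetaVolumeDatumAt (ratPoint (((2 ^ 12 * 13 ^ 3 * 223 ^ 3 : ℕ) : ℚ) / (5 ^ 15 * 179 ^ 4 * 2141 : ℕ))) l) :
    letI := T.instFieldF; letI := T.instNumberFieldF; letI := T.instAlgebraF; letI := T.instFieldK
    letI := T.instNumberFieldK; letI := T.instAlgebraK; letI := T.instFieldFbar; letI := T.instAlgebraFbar
    letI := T.instAlgebraKFbar; letI := T.instIsElliptic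
    ∀ (M : Type) [Field M] [NumberField M]
      (archPk : ∀ (j : (thetaIndex (pilotDataOfK T.D T.K)).Label) (vQ : (thetaIndex (pilotDataOfK T.D T.K)).VQ),
        Set ((logShellsDH (pilotDataOfK T.D T.K) (analyticLogv T.K)).Packet j vQ))
      (archSub : ∀ (j : (thetaIndex (pilotDataOfK T.D T.K)).Label) (v : (thetaIndex (pilotDataOfK T.D T.K)).V),
        Set ((logShellsDH (pilotDataOfK T.D T.K) (analyticLogv T.K)).Packet j ((thetaIndex (pilotDataOfK T.D T.K)).over v)))
      (Ψ : ℤ → ∀ v : (thetaIndex (pilotDataOfK T.D T.K)).V, v ∈ (thetaIndex (pilotDataOfK T.D T.K)).Vbad →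
        Set ((logShellsDH (pilotDataOfK T.D T.K) (analyticLogv T.K)).StarPacket v))
      (act : ℤ → ∀ v : (thetaIndex (pilotDataOfK T.D T.K)).V, v ∈ (thetaIndex (pilotDataOfK T.D T.K)).Vbad →
        (logShellsDH (pilotDataOfK T.D T.K) (analyticLogv T.K)).StarPacket v →
          Module.End ℚ ((logShellsDH (pilotDataOfK T.D T.K) (analyticLogv T.K)).StarPacket v))
      (Mmod : ℤ → ∀ j : (thetaIndex (pilotDataOfK T.D T.K)).LabelStar,
        Set ((logShellsDH (pilotDataOfK T.D T.K) (analyticLogv T.K)).GlobalPacket j.1))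
      (region : ℤ → ∀ j : (thetaIndex (pilotDataOfK T.D T.K)).LabelStar, FinDivisor M →
        ∀ vQ : (thetaIndex (pilotDataOfK T.D T.K)).VQ, Set ((logShellsDH (pilotDataOfK T.D T.K) (analyticLogv T.K)).Packet j.1 vQ))
      (frobAdm : ℤ → ℤ → ∀ (j : (thetaIndex (pilotDataOfK T.D T.K)).Label) (vQ : (thetaIndex (pilotDataOfK T.D T.K)).VQ),
        Set ((logShellsDH (pilotDataOfK T.D T.K) (analyticLogv T.K)).Packet j vQ) → Prop)
      (frobLogvol : ℤ → ℤ → ∀ (j : (thetaIndex (pilotDataOfK T.D T.K)).Label) (vQ : (thetaIndex (pilotDataOfK T.D T.K)).VQ),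
        Set ((logShellsDH (pilotDataOfK T.D T.K) (analyticLogv T.K)).Packet j vQ) → ℝ)
      (frobΨ : ℤ → ℤ → ∀ v : (thetaIndex (pilotDataOfK T.D T.K)).V, v ∈ (thetaIndex (pilotDataOfK T.D T.K)).Vbad →
        Set ((logShellsDH (pilotDataOfK T.D T.K) (analyticLogv T.K)).StarPacket v))
      (frobMmod : ℤ → ℤ → ∀ j : (thetaIndex (pilotDataOfK T.D T.K)).LabelStar,
        Set ((logShellsDH (pilotDataOfK T.D T.K) (analyticLogv T.K)).GlobalPacket j.1))
      (unitImage : ℤ → ℤ → ℕ → ∀ (j : (thetaIndex (pilotDataOfK T.D T.K)).Label) (vQ : (thetaIndex (pilotDataOfK T.D T.K)).VQ),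
        Set ((logShellsDH (pilotDataOfK T.D T.K) (analyticLogv T.K)).Packet j vQ))
      (ballImage : ℤ → ℤ → ∀ (j : (thetaIndex (pilotDataOfK T.D T.K)).Label) (vQ : (thetaIndex (pilotDataOfK T.D T.K)).VQ),
        Set ((logShellsDH (pilotDataOfK T.D T.K) (analyticLogv T.K)).Packet j vQ))
      (thetaDiv : ℤ → ℤ → LgpDivisor M (thetaIndex (pilotDataOfK T.D T.K)).lstar)
      (n : ℤ) {HT : Type} {LogLink : HT → HT → Type} {IsFull : ∀ {s t : HT}, LogLink s t → Prop}
      (lat : LGPGaussianLogThetaLattice LogLink IsFull)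
      {Frd : Type} {IsoF : Frd → Frd → Type} {Ob : Frd → Type} {realify : Frd → Frd} {Strip : Type}
      {IsoS : Strip → Strip → Type} {Mv : ∀ v : (thetaIndex (pilotDataOfK T.D T.K)).V, v ∈ (thetaIndex (pilotDataOfK T.D T.K)).Vbad → Type}
      [∀ v h, Monoid (Mv v h)]
      (sig : GlobalLGPFrobenioidSignature (thetaIndex (pilotDataOfK T.D T.K)).lstar (thetaIndex (pilotDataOfK T.D T.K)).V
        (· ∈ (thetaIndex (pilotDataOfK T.D T.K)).Vbad) Frd IsoF Ob realify Strip IsoS Mv)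
      (split : SplittingMonoids Mv) {ObΔ : Type}
      {N : ∀ v : (thetaIndex (pilotDataOfK T.D T.K)).V, v ∈ (thetaIndex (pilotDataOfK T.D T.K)).Vbad → Type}
      [∀ v h, Monoid (N v h)] (qData : QPilotData ObΔ N)
      (qK : ∀ v : (thetaIndex (pilotDataOfK T.D T.K)).V, v ∈ (thetaIndex (pilotDataOfK T.D T.K)).Vbad →
        Set ((logShellsDH (pilotDataOfK T.D T.K) (analyticLogv T.K)).StarPacket v)),
    ¬ Cor312Vol.PilotKummerCompatHull
        (LatticeSituation.ofShells (logShellsDH (pilotDataOfK T.D T.K) (analyticLogv T.K)) M archPk archSub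
          (summandPiecesPr (pilotDataOfK T.D T.K) (logvAnalytic_analyticLogv (F := T.K))).Adm
          (summandPiecesPr (pilotDataOfK T.D T.K) (logvAnalytic_analyticLogv (F := T.K))).logvol Ψ act Mmod region frobAdm
          frobLogvol frobΨ frobMmod unitImage ballImage thetaDiv)
        (settingPrVolSharp (pilotDataOfK T.D T.K) (logvAnalytic_analyticLogv (F := T.K)) M archPk archSub Ψ act Mmod region n
          lat sig split qData (exists_realising_qIdeles_pilotDataOfK T.D).choose (exists_realising_thetaIdeles_pilotDataOfK T.D).choose
          (exists_realising_qIdeles_pilotDataOfK T.D).choose_spec.1 (exists_realising_qIdeles_pilotDataOfK T.D).choose_spec.2.1)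
        (fun _ => Cor312.Setting.qRegion
          (settingPrVolSharp (pilotDataOfK T.D T.K) (logvAnalytic_analyticLogv (F := T.K)) M archPk archSub Ψ act Mmod region n
            lat sig split qData (exists_realising_qIdeles_pilotDataOfK T.D).choose (exists_realising_thetaIdeles_pilotDataOfK T.D).choose
            (exists_realising_qIdeles_pilotDataOfK T.D).choose_spec.1 (exists_realising_qIdeles_pilotDataOfK T.D).choose_spec.2.1))
        qK := by
  have hcells := WildUnitCells.frey99794037551104_five_band hl h7 h4079
  have hl5 : (5 : ℕ) ≠ l := by omega
  exact GenuineK.not_pilotKummerCompatHull_chosen_triple_of_wildUnitCell (b := 3 ^ 15 * 11 ^ 3 * 97 ^ 5 * 409)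
    isABCTriple_frey99794037551104 T ⟨5, by norm_num⟩ (p' := 3) (Or.inr ⟨rfl, rfl⟩) hl5 (t := 15) (by norm_num) (by norm_num)
    (by norm_num) (by norm_num) (by norm_num) (by norm_num) (i := (l - 1) / 2 - 1) (by omega) hcells

end Summit.ABC.IUTFork.Conditional

end
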